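import Summits.CriticalPhenomena.PercolationContinuityZ3.Theorems.PercNearOneGluingNoHeavyLowerTailFourPointPendantSideCells
import HarnessLib

/-!
# Conjecture W (row `Q44`) at a (3,1) non-terminal cut vertex: the hanging side of a terminal acts as ONE pendant edge (THEOREM D′)

Support file for crux `stmt-CriticalPhenomena-4575` (master-family programme; Conjecture W = row `Q44` = `TwoCopyMono.kerQ44`, open for all `n`), seat `prim-l12-p6`
gen 29; memo `run/shared/lean/prim/prim-l12/FROM-prim-l12-p6-g29-PENDANT-POLARIZATIONS.md` §0 (2) and §3 (d).
SETTING (`FourPointPendantSide.IsPendantSplit`, files `…FourPointPendantSideGluing/Cells`): the side of the terminal `a` hangs off a non-terminal cut vertex `v`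
(the other three terminals lie in the far piece `w₂`).  By the pendant-side gluing table the four-point law of `(a,b,c,y)` under `w` is the PENDANT SUBSTITUTION
`(D_a + θ N_a)` applied to the law `d` of `(v,b,c,y)` under `w₂`, `θ = P_{w₁}(a ↔ v)`, and Conjecture W transforms by the exact identity
**`W(w; a,b,c,y) = θ²·W(w₂; v,b,c,y) + θ(1−θ)·P_a(w₂; v,b,c,y)`** (`P_a` = the pendant form of `…Q44PendantForm`; verified symbolically, code-gen29).
* `IsPendantSplit.of_side` — the split cut out by a vertex set `S ∋ a` (`b, c, y, v ∉ S`, every pair of positive weight leaving `S` ends at `v`);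
* **`ConjWPendantSide.q44_cells_of_pendantSide`** — THEOREM D′: if the far piece satisfies Conjecture W AND the pendant form `P_a` at `(v,b,c,y)`, then `w` satisfies
  Conjecture W at `(a,b,c,y)` (literal cell forms).  With THEOREM D (`…Q44CutVertex`, 2+2) this completes the analysis of non-terminal cut vertices: a vertex-minimal
  counterexample to {W, P_a} has none separating the terminals 2+2, and a (3,1) one forces a violation of W or `P_a` in the smaller far piece.
No named facts, no sorries, standard axioms.
[cite: Grimmett1999, §2.2 (independence of disjoint edge sets)]
-/

noncomputable section

namespace Summit.CriticalPhenomena.PercolationContinuityZ3.Theorems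

open MeasureTheory Set Literature.Probability.LatticeModels Literature.Probability.Percolation
open FourPointAtoms
open Summit.CriticalPhenomena.PercolationContinuityZ3.Cruxes.AdditiveGluing.TieLine.ConnAtoms
open scoped Classical

variable {n : ℕ}

namespace FourPointPendantSide

namespace IsPendantSplit

/-! ## The split cut out by a vertex set -/

/-- **The pendant-side split cut out by a vertex set.**  If `S ∋ a` avoids `b, c, y, v` and every pair of positive weight leaving `S` ends at `v`, then `w`
splits at the cut vertex `v` into its restriction `w₁` to the pairs meeting `S` (the side of `a`) and its restriction `w₂` to the pairs missing `S`. [this work] -/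
theorem of_side (w : Sym2 (Fin n) → unitInterval) (a b c y v : Fin n) (S : Finset (Fin n)) (haS : a ∈ S) (hbS : b ∉ S) (hcS : c ∉ S)
    (hyS : y ∉ S) (hvS : v ∉ S) (hS : ∀ u ∈ S, ∀ x, x ∉ S → x ≠ v → w s(u, x) = 0)
    (hbc : b ≠ c) (hby : b ≠ y) (hbv : b ≠ v) (hcy : c ≠ y) (hcv : c ≠ v) (hyv : y ≠ v) (w₁ w₂ : Sym2 (Fin n) → unitInterval)
    (hw₁ : ∀ e, w₁ e = if (∃ u ∈ S, u ∈ e) then w e else 0) (hw₂ : ∀ e, w₂ e = if (∃ u ∈ S, u ∈ e) then 0 else w e) :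
    IsPendantSplit (Finset.univ.filter fun e => (∃ u ∈ S, u ∈ e) ∧ w e ≠ 0) (Finset.univ.filter fun e => ∀ u ∈ S, u ∉ e)
      w w₁ w₂ a b c y v := by
  -- a pair of positive weight with a vertex in `S` and a vertex `x ∉ S` has `x = v`
  have key : ∀ e : Sym2 (Fin n), (∃ u ∈ S, u ∈ e) → w e ≠ 0 → ∀ x ∈ e, x ∉ S → x = v := by
    intro e hex hwe x hx hxS
    obtain ⟨u, huS, hue⟩ := hex
    have hux : u ≠ x := fun h' => hxS (h' ▸ huS)
    have he : e = s(u, x) := by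
      induction e using Sym2.ind with
      | _ p q =>
        rcases Sym2.mem_iff.1 hue with rfl | rfl <;> rcases Sym2.mem_iff.1 hx with h' | h'
        · exact absurd h'.symm hux
        · rw [h']
        · rw [h']; exact Sym2.eq_swap
        · exact absurd h'.symm hux
    by_contra hxv
    rw [he] at hwe
    exact hwe (hS u huS x hxS hxv)
  exact {
    disjoint := by
      rw [Finset.disjoint_left]
      intro e h1 h2
      rw [Finset.mem_filter] at h1 h2
      obtain ⟨u, huS, hue⟩ := h1.2.1
      exact h2.2 u huS hue
    cut := by
      intro u e₁ he₁ e₂ he₂ hu₁ hu₂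
      rw [Finset.mem_filter] at he₁ he₂
      exact key e₁ he₁.2.1 he₁.2.2 u hu₁ (fun huS => he₂.2 u huS hu₂)
    zero := by
      intro e h1 h2
      rw [Finset.mem_filter, not_and_or] at h1 h2
      rcases h2 with h2 | h2
      · exact absurd (Finset.mem_univ e) h2
      rcases h1 with h1 | h1
      · exact absurd (Finset.mem_univ e) h1
      push Not at h1 h2
      obtain ⟨u, huS, hue⟩ := h2
      exact h1 ⟨u, huS, hue⟩
    left := by
      intro e he
      rw [Finset.mem_filter] at he
      rw [hw₁, if_pos he.2.1]
    left_zero := by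
      intro e he
      rw [Finset.mem_filter, not_and_or] at he
      rw [hw₁]
      split_ifs with hex
      · rcases he with he | he
        · exact absurd (Finset.mem_univ e) he
        · by_contra hne
          exact he ⟨hex, hne⟩
      · rfl
    right := by
      intro e he
      rw [Finset.mem_filter] at he
      rw [hw₂, if_neg (by push Not; exact he.2)]
    right_zero := by
      intro e he
      rw [Finset.mem_filter, not_and_or] at he
      rw [hw₂]
      split_ifs with hex
      · rfl
      · rcases he with he | he
        · exact absurd (Finset.mem_univ e) he
        · push Not at he hex
          obtain ⟨u, huS, hue⟩ := he
          exact absurd hue (hex u huS)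
    b_left := by
      intro e he hbe
      rw [Finset.mem_filter] at he
      exact hbv (key e he.2.1 he.2.2 b hbe hbS)
    c_left := by
      intro e he hce
      rw [Finset.mem_filter] at he
      exact hcv (key e he.2.1 he.2.2 c hce hcS)
    y_left := by
      intro e he hye
      rw [Finset.mem_filter] at he
      exact hyv (key e he.2.1 he.2.2 y hye hyS)
    a_right := by
      intro e he
      rw [Finset.mem_filter] at he
      exact he.2 a haS
    ne_ab := fun h' => hbS (h' ▸ haS)
    ne_ac := fun h' => hcS (h' ▸ haS)
    ne_ay := fun h' => hyS (h' ▸ haS)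
    ne_av := fun h' => hvS (h' ▸ haS)
    ne_bc := hbc
    ne_by := hby
    ne_bv := hbv
    ne_cy := hcy
    ne_cv := hcv
    ne_yv := hyv }


end IsPendantSplit

end FourPointPendantSide

namespace ConjWPendantSide

open FourPointPendantSide FourPointPendantSide.IsPendantSplit

/-- **THEOREM D′ — Conjecture W at a (3,1) non-terminal cut vertex from W and the pendant form of the far piece.**  For a pendant-side split
`IsPendantSplit D₁ D₂ w w₁ w₂ a b c y v` (the side of `a` hangs off the non-terminal cut vertex `v`): if the far piece `w₂` satisfies Conjecture W and the pendant form
`P_a ≥ 0` at the quadruple `(v,b,c,y)`, then `w` satisfies Conjecture W at `(a,b,c,y)`.  Proof: the pendant substitution (`…FourPointPendantSideCells`) and the identity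
`W(w) = θ²·W(w₂) + θ·(1−θ)·P_a(w₂)` with `θ = P_{w₁}(a ↔ v)`, `1 − θ = P_{w₁}(a ↮ v) ≥ 0`. [this work] -/
theorem q44_cells_of_pendantSide {D₁ D₂ : Finset (Sym2 (Fin n))} {w w₁ w₂ : Sym2 (Fin n) → unitInterval} {a b c y v : Fin n}
    (h : IsPendantSplit D₁ D₂ w w₁ w₂ a b c y v)
    (hW : 2 * (cell w₂ v b c y 11 * cell w₂ v b c y 9 + cell w₂ v b c y 11 * cell w₂ v b c y 8 + cell w₂ v b c y 6 * cell w₂ v b c y 8 +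
        cell w₂ v b c y 6 * cell w₂ v b c y 1 + cell w₂ v b c y 1 * cell w₂ v b c y 8) +
        (cell w₂ v b c y 2 * cell w₂ v b c y 13 + cell w₂ v b c y 1 * cell w₂ v b c y 13 + cell w₂ v b c y 5 * cell w₂ v b c y 12 +
        cell w₂ v b c y 1 * cell w₂ v b c y 12 + cell w₂ v b c y 6 * cell w₂ v b c y 10 + cell w₂ v b c y 6 * cell w₂ v b c y 7 +
          cell w₂ v b c y 2 * cell w₂ v b c y 10 + cell w₂ v b c y 5 * cell w₂ v b c y 7) ≤
      2 * ((cell w₂ v b c y 11 + cell w₂ v b c y 14) * cell w₂ v b c y 0))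
    (hPa : 2 * ((cell w₂ v b c y 1 + cell w₂ v b c y 10 + cell w₂ v b c y 11) * (cell w₂ v b c y 6 + cell w₂ v b c y 8)) +
          (cell w₂ v b c y 2 + cell w₂ v b c y 9 + cell w₂ v b c y 12) * (cell w₂ v b c y 10 + cell w₂ v b c y 13) +
          (cell w₂ v b c y 1 + cell w₂ v b c y 10 + cell w₂ v b c y 11) * (cell w₂ v b c y 12 + cell w₂ v b c y 13) +
          (cell w₂ v b c y 7 + cell w₂ v b c y 14) * (cell w₂ v b c y 5 + cell w₂ v b c y 6) ≤
      2 * ((cell w₂ v b c y 11 + cell w₂ v b c y 14) * (cell w₂ v b c y 0 + cell w₂ v b c y 4 + cell w₂ v b c y 5 + cell w₂ v b c y 6))) :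
    2 * (cell w a b c y 11 * cell w a b c y 9 + cell w a b c y 11 * cell w a b c y 8 + cell w a b c y 6 * cell w a b c y 8 +
        cell w a b c y 6 * cell w a b c y 1 + cell w a b c y 1 * cell w a b c y 8) +
        (cell w a b c y 2 * cell w a b c y 13 + cell w a b c y 1 * cell w a b c y 13 + cell w a b c y 5 * cell w a b c y 12 +
        cell w a b c y 1 * cell w a b c y 12 + cell w a b c y 6 * cell w a b c y 10 + cell w a b c y 6 * cell w a b c y 7 +
          cell w a b c y 2 * cell w a b c y 10 + cell w a b c y 5 * cell w a b c y 7) ≤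
      2 * ((cell w a b c y 11 + cell w a b c y 14) * cell w a b c y 0) := by
  have hA0 : 0 ≤ (prodBernoulli w₁).real (atom (pmark a b c y v) (sideA 0)) := measureReal_nonneg
  have hθ : 0 ≤ (prodBernoulli w₁).real (atom (pmark a b c y v) (sideA 1)) := measureReal_nonneg
  have t1 : 0 ≤ ((prodBernoulli w₁).real (atom (pmark a b c y v) (sideA 1)) * (prodBernoulli w₁).real (atom (pmark a b c y v) (sideA 1))) *
      (2 * ((cell w₂ v b c y 11 + cell w₂ v b c y 14) * cell w₂ v b c y 0) - (2 * (cell w₂ v b c y 11 * cell w₂ v b c y 9 + cell w₂ v b c y 11 * cell w₂ v b c y 8 + cell w₂ v b c y 6 * cell w₂ v b c y 8 + cell w₂ v b c y 6 * cell w₂ v b c y 1 + cell w₂ v b c y 1 * cell w₂ v b c y 8) +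
        (cell w₂ v b c y 2 * cell w₂ v b c y 13 + cell w₂ v b c y 1 * cell w₂ v b c y 13 + cell w₂ v b c y 5 * cell w₂ v b c y 12 + cell w₂ v b c y 1 * cell w₂ v b c y 12 + cell w₂ v b c y 6 * cell w₂ v b c y 10 + cell w₂ v b c y 6 * cell w₂ v b c y 7 + cell w₂ v b c y 2 * cell w₂ v b c y 10 + cell w₂ v b c y 5 * cell w₂ v b c y 7))) :=
    mul_nonneg (mul_nonneg hθ hθ) (by linarith [hW])
  have t2 : 0 ≤ ((prodBernoulli w₁).real (atom (pmark a b c y v) (sideA 0)) * (prodBernoulli w₁).real (atom (pmark a b c y v) (sideA 1))) *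
      (2 * ((cell w₂ v b c y 11 + cell w₂ v b c y 14) * (cell w₂ v b c y 0 + cell w₂ v b c y 4 + cell w₂ v b c y 5 + cell w₂ v b c y 6)) - (2 * ((cell w₂ v b c y 1 + cell w₂ v b c y 10 + cell w₂ v b c y 11) * (cell w₂ v b c y 6 + cell w₂ v b c y 8)) +
        (cell w₂ v b c y 2 + cell w₂ v b c y 9 + cell w₂ v b c y 12) * (cell w₂ v b c y 10 + cell w₂ v b c y 13) + (cell w₂ v b c y 1 + cell w₂ v b c y 10 + cell w₂ v b c y 11) * (cell w₂ v b c y 12 + cell w₂ v b c y 13) + (cell w₂ v b c y 7 + cell w₂ v b c y 14) * (cell w₂ v b c y 5 + cell w₂ v b c y 6))) :=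
    mul_nonneg (mul_nonneg hA0 hθ) (by linarith [hPa])
  rw [h.cell0, h.cell1, h.cell2, h.cell5, h.cell6, h.cell7, h.cell8, h.cell9, h.cell10, h.cell11, h.cell12, h.cell13, h.cell14]
  nlinarith [t1, t2]

end ConjWPendantSide

end Summit.CriticalPhenomena.PercolationContinuityZ3.Theorems
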